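import Summits.BirchSwinnertonDyer.BirchSwinnertonDyer.Theorems.KolyvaginRoadThreeZhangSupplyOrdinaryLagrangian
import Summits.BirchSwinnertonDyer.BirchSwinnertonDyer.Theorems.KolyvaginRoadThreeMethod2LocalInputsLineTrans
import Summits.BirchSwinnertonDyer.Rank1Residual.GaloisImage.LocalH1UnramifiedSquare
import Literature.NumberTheory.GaloisRepresentations.UnramifiedKummer
import Literature.NumberTheory.GaloisRepresentations.GaloisCohomologyKummerProofs
import Literature.NumberTheory.GaloisRepresentations.DecompositionGroupOfCompletion
import Literature.NumberTheory.GaloisRepresentations.LocalExistenceTameProofs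
import Literature.NumberTheory.Automorphic.BCDTTheoremBWildAtThreeLocal
import Literature.NumberTheory.EllipticCurves.GoodReductionUnramifiedProofs
import HarnessLib

/-!
# Route `KolyvaginRoadThree`, deciding crux `ZhangSharpFrameAtThreeHL` (item stmt-BirchSwinnertonDyer-19574):
# (Lag-ord) part 2 — a NON-ZERO genuine ordinary class from a RAMIFIED KUMMER CHARACTER, and the count
# `#Lord v · #Lord v = #H¹(K_v, E[3])` above every good unipotent-admissible prime
# (cell `bsd-stepL`, ACCEL seat `bsd-stepL-koly3b` g6; `--supports stmt-BirchSwinnertonDyer-19574`, helper; part XX of the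
# `KolyvaginRoadThreeZhangSupply*` series)

HONEST FRAMING. Theorems only; 0 definitions, 0 named facts, 0 `sorry`; closes nothing (T7). PARTITION: O2@3 (B10) × A1 ×
crux 19574 × the S2-ENGINE's (Supply) binder — proves-glue.

WHAT. With part XIX (isotropy ⟹ `#Lord ≤ 3` when `#H¹(K_v, E[3]) = 9`) the clause `hordCard` of `hjump_of_localLagrangians`
for `Lord v := Method2.ordinaryLocalCondition (E/K) K_v 3` needs ONE non-zero ordinary local class. §1
`exists_ne_zero_mem_ordinaryLocalCondition` builds it for any `K`-field `L` with a non-archimedean local field structure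
whose inertia group fixes `E[n]`, containing a primitive `n`-th root of unity, and any non-zero `Γ_L`-fixed `P₀ ∈ E[n]`:
for a uniformiser `ϖ` and `z = ϖ^{1/n}`, `σ ↦ k(σ) • P₀` (`σ z = ζ^{k(σ)} z`; a homomorphism because `μ_n ⊂ L`) is a
continuous invariant-valued cocycle whose class is NOT a coboundary — coboundaries vanish on inertia, while the tree's
surjectivity of the Kummer character on inertia (`IsNonarchimedeanLocalField.exists_mem_absInertia_smul_eq_mul`, Serre 1972
§1.3) gives `σ₀ ∈ I_L` with `σ₀ z = ζ z`, where the cocycle is `P₀`. §2 instantiates at the place `v ∣ q` of a good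
unipotent-admissible prime: `I_{K_v}` fixes `E[3]` (Silverman VII.4.1 via `smul_geomTorsion_eq_of_mem_inertia` and
`I_{𝔓₀} = res I_{K_v}`, `inertia_adicCompletionPrime_eq_map_absInertia`); `μ₃ ⊂ K_v` (`q ≡ 1 (mod 3)` so the residue field
has `q^f ≡ 1 (mod 3)` elements; Teichmüller lift `exists_isPrimitiveRoot_residueFieldCard_sub_one`); and the COUNT
`hordCard_ordinaryLocalCondition`: `h⁰ := #E[3]^{Γ_v} ∈ {1, 3}` (koly g13 LocalH0), `#H¹ = (h⁰)²` (Milne I 2.8, n1011); for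
`h⁰ = 1` all is trivial, for `h⁰ = 3` isotropy gives `#Lord ≤ 3` and the witness `#Lord ≥ 3`. So (Lag-ord) of part XVIII is
DISCHARGED: `hjump` ⟸ {PT fact, (Lag-tr) at Kolyvagin primes}.

References: [cite: BertoliniDarmon2005, §2.2–§2.3 (H¹_ord one-dimensional)] [cite: SerreInventiones1972, §1.3 (θ_d)]
[cite: SilvermanAEC2009, Prop. VII.4.1(a)] [cite: NeukirchANT1999, Ch. II §9 Prop. (9.6)] [cite: SerreLocalFields1979,
Ch. II §4 Prop. 8] [cite: MilneADT2006, Ch. I, Thm. 2.8] [cite: WZhang2014, Notations (xii), §4.1].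
-/

noncomputable section

open scoped Classical

universe u

namespace Summit.BirchSwinnertonDyer.Rank1Residual.X11b.Three.Koly.ZhangSupply

open CategoryTheory WeierstrassCurve Field Function NumberField IsDedekindDomain
open Literature.NumberTheory.EllipticCurves Literature.NumberTheory.GaloisRepresentations
open Literature.NumberTheory.GaloisRepresentations.IsNonarchimedeanLocalField
open Summit.BirchSwinnertonDyer.Rank1Residual.X11b.Three.Koly.Method2
open Summit.BirchSwinnertonDyer.Rank1Residual.GaloisImage
open scoped ValuativeRel

/-! ## §1 The witness: a non-zero ordinary class from a ramified Kummer character -/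

section Witness

variable {K : Type u} [Field K] (E : WeierstrassCurve K) (n : ℕ)
variable (L : Type u) [Field L] [Algebra K L] [ValuativeRel L] [TopologicalSpace L] [IsNonarchimedeanLocalField L]

/-- `m • P` only depends on `m mod n` for an `n`-torsion point. [folklore] -/
theorem nsmul_eq_nsmul_of_modEq {P : geomTorsion E n} {a b : ℕ} (h : a ≡ b [MOD n]) : a • P = b • P := by
  have hn : n • P = 0 := by
    have := AddSubgroup.torsionBy.nsmul P
    exact_mod_cast this
  have key : ∀ c : ℕ, c • P = (c % n) • P := fun c ↦ by
    conv_lhs => rw [← Nat.mod_add_div c n, add_nsmul, mul_nsmul, hn, nsmul_zero, add_zero]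
  rw [key a, key b, h]

/-- **A non-zero class in the genuine ordinary condition from a ramified Kummer character.** Let `L` be a `K`-field
carrying a non-archimedean local field structure whose inertia group `I_L` acts trivially on `E[n](K̄)` (through
`res : Γ_L → Γ_K`), containing a primitive `n`-th root of unity `ζ` (`1 < n`), and let `P₀ ≠ 0` be a `Γ_L`-fixed point of
`E[n]`. For a uniformiser `ϖ` and `z = ϖ^{1/n} ∈ L̄`, the map `σ ↦ k(σ) • P₀` (`σ z = ζ^{k(σ)} z`; a homomorphism since
`μ_n ⊂ L`) is a continuous cocycle of `E[n]|_{Γ_L}` valued in the fixed points, and its class is NON-ZERO: a coboundary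
`∂m` vanishes on `I_L` (which fixes `E[n]`), while some `σ₀ ∈ I_L` has `σ₀ z = ζ z` (surjectivity of the Kummer character
on inertia, tree `exists_mem_absInertia_smul_eq_mul`), where the cocycle takes the value `P₀`. This is the ramified line
of `H¹_ord(K_q, E[p]) = im H¹(K_q, F⁺)`. [cite: BertoliniDarmon2005, §2.2–§2.3 (H¹_ord, dim 1)]
[cite: SerreInventiones1972, §1.3 (θ_d : Gal(K_d/K_nr) ≃ μ_d)] -/
theorem exists_ne_zero_mem_ordinaryLocalCondition [NeZero n] (h1 : 1 < n)
    (hI : ∀ σ ∈ absInertia L, ∀ P : geomTorsion E n, absGaloisRestrict K L σ • P = P)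
    {ζ : L} (hζ : IsPrimitiveRoot ζ n) {P₀ : geomTorsion E n} (hP₀ : P₀ ≠ 0)
    (hfix : ∀ τ : absoluteGaloisGroup L, absGaloisRestrict K L τ • P₀ = P₀) :
    ∃ a ∈ ordinaryLocalCondition E L (n : ℤ), a ≠ 0 := by
  have hn0 : 0 < n := lt_trans zero_lt_one h1
  -- a uniformiser `ϖ`, a root `z` of `z ^ n = ϖ`, the root of unity `ζ' = ζ ∈ L̄`
  obtain ⟨ϖ, hϖ⟩ := IsDiscreteValuationRing.exists_irreducible 𝒪[L]
  obtain ⟨z, hz⟩ := IsAlgClosed.exists_pow_nat_eq (algebraMap 𝒪[L] (AlgebraicClosure L) ϖ) hn0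
  have hϖ0 : (algebraMap 𝒪[L] (AlgebraicClosure L) ϖ) ≠ 0 := by
    rw [IsScalarTower.algebraMap_apply 𝒪[L] L (AlgebraicClosure L), map_ne_zero_iff _ (algebraMap L _).injective]
    change ((ϖ : L)) ≠ 0
    rw [Ne, ZeroMemClass.coe_eq_zero]
    exact hϖ.ne_zero
  have hz0 : z ≠ 0 := fun h ↦ hϖ0 (by rw [← hz, h, zero_pow hn0.ne'])
  set ζ' : AlgebraicClosure L := algebraMap L (AlgebraicClosure L) ζ with hζ'def
  have hζ' : IsPrimitiveRoot ζ' n := hζ.map_of_injective (algebraMap L (AlgebraicClosure L)).injective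
  have hfixζ : ∀ (σ : absoluteGaloisGroup L) (i : ℕ), σ • ζ' ^ i = ζ' ^ i := fun σ i ↦ by
    rw [smul_pow']
    exact congrArg (· ^ i) (AlgEquiv.commutes σ ζ)
  have hmodpow : ∀ b : ℕ, ζ' ^ b = ζ' ^ (b % n) := fun b ↦ by
    conv_lhs => rw [← Nat.div_add_mod b n, pow_add, pow_mul, hζ'.pow_eq_one, one_pow, one_mul]
  -- the inertia element `σ₀` with `σ₀ z = ζ z`
  obtain ⟨σ₀, hσ₀I, hσ₀⟩ := exists_mem_absInertia_smul_eq_mul hn0 hϖ hz hζ'.pow_eq_one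
  -- the Kummer character: `σ z = ζ' ^ k(σ) · z`
  have hzn : ∀ σ : absoluteGaloisGroup L, σ • z ^ n = z ^ n := fun σ ↦ by
    rw [hz, IsScalarTower.algebraMap_apply 𝒪[L] L (AlgebraicClosure L)]
    exact AlgEquiv.commutes σ _
  have hpow : ∀ σ : absoluteGaloisGroup L, (σ • z / z) ^ n = 1 := fun σ ↦ by
    rw [div_pow, ← smul_pow', hzn, div_self (pow_ne_zero n hz0)]
  let K' : AlgebraicClosure L → ℕ := fun w ↦
    if h : (w / z) ^ n = 1 then Classical.choose (hζ'.eq_pow_of_pow_eq_one h) else 0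
  let k : absoluteGaloisGroup L → ℕ := fun σ ↦ K' (σ • z)
  have hk : ∀ σ, k σ < n ∧ ζ' ^ k σ = σ • z / z := fun σ ↦ by
    have h := Classical.choose_spec (hζ'.eq_pow_of_pow_eq_one (hpow σ))
    simp only [k, K', dif_pos (hpow σ)]
    exact h
  have hkz : ∀ σ : absoluteGaloisGroup L, σ • z = ζ' ^ k σ * z := fun σ ↦ by
    rw [(hk σ).2, div_mul_cancel₀ _ hz0]
  -- `k` is additive modulo `n`
  have hkmul : ∀ σ τ : absoluteGaloisGroup L, k (σ * τ) ≡ k σ + k τ [MOD n] := by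
    intro σ τ
    have h : ζ' ^ k (σ * τ) = ζ' ^ (k σ + k τ) := by
      have e1 : (σ * τ) • z = ζ' ^ k (σ * τ) * z := hkz (σ * τ)
      rw [mul_smul, hkz τ, smul_mul', hfixζ, hkz σ, ← mul_assoc, ← pow_add, add_comm] at e1
      exact mul_right_cancel₀ hz0 e1.symm
    rw [hmodpow (k σ + k τ)] at h
    have h' := hζ'.pow_inj (hk (σ * τ)).1 (Nat.mod_lt _ hn0) h
    change k (σ * τ) % n = (k σ + k τ) % n
    rw [Nat.mod_eq_of_lt (hk (σ * τ)).1, h']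
  -- `k σ₀ = 1`
  have hkσ₀ : k σ₀ = 1 := by
    have h : ζ' ^ k σ₀ = ζ' ^ 1 := by
      have e1 := hkz σ₀
      rw [hσ₀] at e1
      rw [pow_one]
      exact (mul_right_cancel₀ hz0 e1).symm
    exact hζ'.pow_inj (hk σ₀).1 h1 h
  -- local constancy of `σ ↦ σ • z`, hence of `σ ↦ k σ • P₀`
  have hlc : IsLocallyConstant fun σ : absoluteGaloisGroup L ↦ σ • z :=
    (isLocallyConstant_smul_units L (Units.mk0 z hz0)).comp Units.val
  have hlcψ : IsLocallyConstant fun σ : absoluteGaloisGroup L ↦ k σ • P₀ := hlc.comp fun w ↦ K' w • P₀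
  -- `Γ_L` fixes the multiples of `P₀`
  have hfix' : ∀ (τ : absoluteGaloisGroup L) (m : ℕ), absGaloisRestrict K L τ • (m • P₀) = m • P₀ := fun τ m ↦ by
    rw [smul_comm, hfix]
  -- the cocycle `σ ↦ k σ • P₀` of the restricted module
  let ψ : contOneCocycles (DiscreteGaloisModule.toTopRep (GaloisRep.restrictField L (E.torsionGaloisModule n))) :=
    ⟨⟨fun σ ↦ k σ • P₀, hlcψ.continuous⟩, fun g h ↦ by
      change k (g * h) • P₀ = k g • P₀ + absGaloisRestrict K L g • (k h • P₀)
      rw [hfix', ← add_nsmul]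
      exact nsmul_eq_nsmul_of_modEq E n (hkmul g h)⟩
  have hψ : ∀ σ, ψ.1 σ = k σ • P₀ := fun σ ↦ rfl
  refine ⟨oneCocycleClass _ ψ, ⟨ψ, fun σ τ ↦ by rw [hψ, hfix'], rfl⟩, fun h0 ↦ ?_⟩
  obtain ⟨m, hm⟩ := (oneCocycleClass_eq_zero_iff _ _).mp h0
  have h := hm σ₀
  change k σ₀ • P₀ = absGaloisRestrict K L σ₀ • m - m at h
  rw [hI σ₀ hσ₀I m, sub_self, hkσ₀, one_nsmul] at h
  exact hP₀ h

end Witness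

/-! ## §2 The frame: (Lag-ord) at the place of a good unipotent-admissible prime -/

section FrameCount

variable (W : WeierstrassCurve ℚ) (K : Type) [Field K] [NumberField K] [W.IsElliptic] [W.IsGloballyMinimal]

omit [W.IsGloballyMinimal] in
/-- **The inertia group of `K_v` acts trivially on `E[3](K̄)`** at a finite place `v ∤ 3` of good reduction (Silverman
VII.4.1 via the tree's `smul_geomTorsion_eq_of_mem_inertia`, transported to `I_{K_v}` by `I_{𝔓₀} = res(I_{K_v})`,
`inertia_adicCompletionPrime_eq_map_absInertia`). [cite: SilvermanAEC2009, Prop. VII.4.1(a)]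
[cite: NeukirchANT1999, Ch. II §9 Prop. (9.6)] -/
theorem absInertia_smul_geomTorsion_eq (v : HeightOneSpectrum (𝓞 K)) (hgood : (W.baseChange K).HasGoodReductionAt v)
    (h3 : ((((3 ^ 1 : ℕ) : ℤ)) : 𝓞 K) ∉ v.asIdeal) :
    ∀ σ ∈ absInertia (v.adicCompletion K), ∀ P : geomTorsion (W.baseChange K) ((3 ^ 1 : ℕ) : ℤ),
      absGaloisRestrict K (v.adicCompletion K) σ • P = P := by
  intro σ hσ P
  have hmem : absGaloisRestrict K (v.adicCompletion K) σ ∈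
      (adicCompletionPrime K v).inertia (absoluteGaloisGroup K) := by
    rw [inertia_adicCompletionPrime_eq_map_absInertia]
    exact ⟨σ, hσ, rfl⟩
  exact (W.baseChange K).smul_geomTorsion_eq_of_mem_inertia hgood h3 (adicCompletionPrime_mem_primesAbove K v) hmem P

omit [W.IsElliptic] in
/-- **`K_v` contains a primitive cube root of unity** above a unipotent-admissible prime `q` (`q ≡ 1 (mod 3)`, so the
residue field `𝓞_K/v ⊇ 𝔽_q` has `q^f ≡ 1 (mod 3)` elements; Teichmüller lift, tree
`exists_isPrimitiveRoot_residueFieldCard_sub_one`). [cite: SerreLocalFields1979, Ch. II §4 Prop. 8]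
[cite: WZhang2014, Notations (xii)] -/
theorem exists_isPrimitiveRoot_three_adicCompletion (q : {q // IsUAdmissiblePrime W K q})
    (v : HeightOneSpectrum (𝓞 K)) (hqv : ((q : ℕ) : 𝓞 K) ∈ v.asIdeal) :
    ∃ ζ : v.adicCompletion K, IsPrimitiveRoot ζ 3 := by
  have hqp : (q : ℕ).Prime := q.2.1
  have hq1 : (q : ℕ) % 3 = 1 := q.2.2.2.2.2.2.1
  -- the residue field `𝓞 K ⧸ v` has `q ^ f` elements
  haveI : v.asIdeal.IsMaximal := v.isMaximal
  letI : Field (𝓞 K ⧸ v.asIdeal) := Ideal.Quotient.field v.asIdeal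
  haveI : Finite (𝓞 K ⧸ v.asIdeal) := Ideal.finiteQuotientOfFreeOfNeBot v.asIdeal v.ne_bot
  letI : Fintype (𝓞 K ⧸ v.asIdeal) := Fintype.ofFinite _
  have hchar : ringChar (𝓞 K ⧸ v.asIdeal) = q := by
    have h0 : ((q : ℕ) : 𝓞 K ⧸ v.asIdeal) = 0 := by
      rw [← map_natCast (Ideal.Quotient.mk v.asIdeal), Ideal.Quotient.eq_zero_iff_mem]
      exact hqv
    have hdvd : ringChar (𝓞 K ⧸ v.asIdeal) ∣ q := (ringChar.spec _ _).mp h0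
    rcases (Nat.dvd_prime hqp).mp hdvd with h | h
    · exact absurd h (CharP.ringChar_ne_one)
    · exact h
  haveI : CharP (𝓞 K ⧸ v.asIdeal) q := ringChar.eq_iff.mp hchar
  obtain ⟨f, -, hcard⟩ := FiniteField.card (𝓞 K ⧸ v.asIdeal) q
  have hcard' : residueFieldCard (v.adicCompletion K) = q ^ (f : ℕ) := by
    rw [residueFieldCard_adicCompletion_eq_card_quotient, Nat.card_eq_fintype_card, hcard]
  have hmod : residueFieldCard (v.adicCompletion K) % 3 = 1 := by
    rw [hcard', Nat.pow_mod, hq1, one_pow]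
    exact Nat.one_mod_eq_one.mpr (by norm_num)
  have h1lt := one_lt_residueFieldCard (v.adicCompletion K)
  have hdvd3 : 3 ∣ residueFieldCard (v.adicCompletion K) - 1 :=
    (Nat.modEq_iff_dvd' h1lt.le).mp (by unfold Nat.ModEq; omega)
  obtain ⟨ζ₀, hζ₀⟩ := exists_isPrimitiveRoot_residueFieldCard_sub_one (v.adicCompletion K)
  obtain ⟨c, hc⟩ := hdvd3
  refine ⟨ζ₀ ^ c, hζ₀.pow (Nat.sub_pos_of_lt h1lt) ?_⟩
  rw [hc, mul_comm]

/-- **(Lag-ord), the count clause `hordCard`** of `hjump_of_localLagrangians` for `Lord v := ordinaryLocalCondition`: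
above a GOOD unipotent-admissible prime, `#Lord v · #Lord v = #H¹(K_v, E[3])`. With `h⁰ = #E[3]^{Γ_v} ∈ {1, 3}` (koly
g13 LocalH0) and `#H¹(K_v, E[3]) = (h⁰)²` (Milne I Thm 2.8, n1011): if `h⁰ = 1` everything is trivial; if `h⁰ = 3` the
isotropy gives `#Lord ≤ 3` and the ramified Kummer class (`exists_ne_zero_mem_ordinaryLocalCondition`) gives
`#Lord ≥ 3`. [cite: BertoliniDarmon2005, §2.2–§2.3 (dim H¹_ord = 1)] [cite: MilneADT2006, Ch. I, Thm. 2.8] -/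
theorem hordCard_ordinaryLocalCondition (hK : IsImaginaryQuadratic K)
    (q : {q // IsUAdmissiblePrime W K q}) (hq : FrobSqNeOneAt W 3 q.1)
    (v : HeightOneSpectrum (𝓞 K)) (hqv : ((q : ℕ) : 𝓞 K) ∈ v.asIdeal) :
    Nat.card (ordinaryLocalCondition (W.baseChange K) (v.adicCompletion K) ((3 ^ 1 : ℕ) : ℤ)) *
        Nat.card (ordinaryLocalCondition (W.baseChange K) (v.adicCompletion K) ((3 ^ 1 : ℕ) : ℤ)) =
      Nat.card (galoisCohomology (((W.baseChange K).torsionGaloisModule ((3 ^ 1 : ℕ) : ℤ)).toLocal (Sum.inr v)) 1) := by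
  haveI : Fact (3 : ℕ).Prime := ⟨Nat.prime_three⟩
  haveI : NeZero (3 ^ 1 : ℕ) := ⟨by norm_num⟩
  haveI : CharZero (v.adicCompletion K) := charZero_of_injective_algebraMap (algebraMap K _).injective
  haveI : Finite (geomTorsion (W.baseChange K) ((3 ^ 1 : ℕ) : ℤ)) := finite_geomTorsion_of_neZero _ _
  haveI hfinH' : Finite (galoisCohomology (GaloisRep.restrictField (v.adicCompletion K)
      ((W.baseChange K).torsionGaloisModule ((3 ^ 1 : ℕ) : ℤ))) 1) :=
    KummerPT.finite_galoisCohomology_toLocal_inr (W.baseChange K) (3 ^ 1) v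
  obtain ⟨hgood, h3v⟩ := hasGoodReductionAt_of_uAdmissible W K q.2 v hqv
  set Lv := ordinaryLocalCondition (W.baseChange K) (v.adicCompletion K) ((3 ^ 1 : ℕ) : ℤ) with hLv
  set inv := (GaloisRep.restrictField (v.adicCompletion K)
      ((W.baseChange K).torsionGaloisModule ((3 ^ 1 : ℕ) : ℤ))).toTopRep.ρ.invariants with hinvdef
  -- `#H¹ = (h⁰)²`
  have h3v' : ((3 : ℕ) : 𝓞 K) ∉ v.asIdeal := by
    have h := h3v; rwa [Int.cast_natCast, pow_one] at h
  have hH : Nat.card (galoisCohomology (((W.baseChange K).torsionGaloisModule ((3 ^ 1 : ℕ) : ℤ)).toLocal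
      (Sum.inr v)) 1) = Nat.card inv ^ 2 := by
    have h1 := LocalH1UnramifiedSquare.natCard_galoisCohomology_one_primeTorsion_adicCompletion_eq_sq_of_not_mem
      (W.baseChange K) v 3 h3v'
    have h0 := natCard_invariants_torsion_restrictField (W.baseChange K) (v.adicCompletion K) (n := 3) (by norm_num)
    change Nat.card (galoisCohomology
      (GaloisRep.restrictField (v.adicCompletion K) ((W.baseChange K).torsionGaloisModule ((3 : ℕ) : ℤ))) 1) =
        Nat.card (GaloisRep.restrictField (v.adicCompletion K)
          ((W.baseChange K).torsionGaloisModule ((3 : ℕ) : ℤ))).toTopRep.ρ.invariants ^ 2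
    rw [h1, ← h0]
  -- `h⁰ ∈ {1, 3}`
  have hle3 : Nat.card inv ≤ 3 := Iso.natCard_invariants_le_three_of_frobSqNeOneAt W K hK q hq v hqv
  have hdvd9 : Nat.card inv ∣ 3 ^ 2 := by
    have h9 : Nat.card (geomTorsion (W.baseChange K) ((3 ^ 1 : ℕ) : ℤ)) = 3 ^ 2 := by
      rw [natCard_geomTorsion (W.baseChange K) ((3 ^ 1 : ℕ) : ℤ) (by norm_num)]; norm_num
    rw [← h9]
    exact inv.toAddSubgroup.card_addSubgroup_dvd_card
  obtain ⟨i, hi, hcardinv⟩ := (Nat.dvd_prime_pow Nat.prime_three).mp hdvd9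
  -- `#Lord ∣ #H¹`
  haveI hfinH : Finite (galoisCohomology (((W.baseChange K).torsionGaloisModule ((3 ^ 1 : ℕ) : ℤ)).toLocal
      (Sum.inr v)) 1) := KummerPT.finite_galoisCohomology_toLocal_inr (W.baseChange K) (3 ^ 1) v
  have hLdvd : Nat.card Lv ∣ Nat.card (galoisCohomology (((W.baseChange K).torsionGaloisModule
      ((3 ^ 1 : ℕ) : ℤ)).toLocal (Sum.inr v)) 1) := Lv.card_addSubgroup_dvd_card
  interval_cases i
  · -- `h⁰ = 1`: `H¹ = 0`
    rw [pow_zero] at hcardinv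
    rw [hcardinv, one_pow] at hH
    rw [hH, Nat.dvd_one] at hLdvd
    rw [hLdvd, hH, mul_one]
  · -- `h⁰ = 3`: `#H¹ = 9`, `#Lord = 3`
    have hcardinv' : Nat.card inv = 3 := by rw [hcardinv, pow_one]
    rw [hcardinv'] at hH
    -- upper bound from isotropy
    have hle : Nat.card Lv * Nat.card Lv ≤ 3 ^ 2 := by
      have h := natCard_mul_natCard_le_of_isotropic W K hK v Lv
        (fun e hμ hadd₁ hadd₂ halt _ hgal ↦ hordIso_ordinaryLocalCondition W K hK q hq v hqv e hμ hadd₁ hadd₂ halt hgal)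
      rw [hH] at h; exact h
    have hle' : Nat.card Lv ≤ 3 := by
      by_contra hgt
      push Not at hgt
      have h16 : 4 * 4 ≤ Nat.card Lv * Nat.card Lv := Nat.mul_le_mul hgt hgt
      norm_num at hle
      omega
    -- a non-zero fixed point `P₀`
    have hnt : Nontrivial inv := by
      rw [← Finite.one_lt_card_iff_nontrivial, hcardinv']; norm_num
    obtain ⟨x, hx⟩ := exists_ne (0 : inv)
    have hP₀ : (x : geomTorsion (W.baseChange K) ((3 ^ 1 : ℕ) : ℤ)) ≠ 0 := fun h ↦ hx (Subtype.ext h)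
    have hfix : ∀ τ : absoluteGaloisGroup (v.adicCompletion K),
        absGaloisRestrict K (v.adicCompletion K) τ • (x : geomTorsion (W.baseChange K) ((3 ^ 1 : ℕ) : ℤ)) = x := by
      intro τ
      have h := (ContRepresentation.mem_invariants _).mp x.2 τ
      exact h
    -- the ramified ordinary class
    obtain ⟨ζ, hζ⟩ := exists_isPrimitiveRoot_three_adicCompletion W K q v hqv
    have hζ' : IsPrimitiveRoot ζ (3 ^ 1) := by rwa [pow_one]
    obtain ⟨a, ha, ha0⟩ := exists_ne_zero_mem_ordinaryLocalCondition (W.baseChange K) (3 ^ 1) (v.adicCompletion K)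
      (by norm_num) (absInertia_smul_geomTorsion_eq W K v hgood h3v) hζ' hP₀ hfix
    have hnt' : Nontrivial Lv := ⟨⟨⟨a, ha⟩, 0, fun h ↦ ha0 (congrArg Subtype.val h)⟩⟩
    have hlt : 1 < Nat.card Lv := Finite.one_lt_card_iff_nontrivial.mpr hnt'
    rw [hH] at hLdvd ⊢
    obtain ⟨j, hj, hcardL⟩ := (Nat.dvd_prime_pow Nat.prime_three).mp hLdvd
    interval_cases j
    · rw [pow_zero] at hcardL; omega
    · have hcardL' : Nat.card Lv = 3 := by rw [hcardL, pow_one]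
      rw [hcardL']; norm_num
    · have hcardL' : Nat.card Lv = 9 := by rw [hcardL]; norm_num
      rw [hcardL'] at hle'; norm_num at hle'
  · -- `h⁰ = 9` is excluded by (H0)
    rw [hcardinv] at hle3; norm_num at hle3

end FrameCount

end Summit.BirchSwinnertonDyer.Rank1Residual.X11b.Three.Koly.ZhangSupply

end
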